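import Summits.QuantumAdvantage.AdviceFreeQNC0.RegisterChainWalk
import Summits.QuantumAdvantage.AdviceFreeQNC0.TwistBoundX3Proof
import HarnessLib

/-!
# Cell qa-qnc0, `p = 3` — the register chain of an `r`-LOCAL bell rule: site signs, final vector, the pointwise identity
(prover qn-prover-3 g22; bookkeeping for `twistBoundX3Local_of`, planner qa-qnc0-p1 g20 `exp20/Sketch20x.lean` §7)

For an `r`-local rule `t` (`IsLocalRule (n+1) r t`), a final-state guess `τ`, a charge constant `κ` and a letter PREFIX
`a ∈ {0,1}^{2r}`, the twisted sign weight of a walk input `u`,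

  `e₃(Σ_{i ≤ n} [x_i] γ_i) · [st u n = τ] · Π_{k ≤ n} (−1)^{[t k x ∧ κ + st u k + τ ≠ 0]}`     (`x = xOfU u`),

is the explicit path weight (`pathW`, `RegisterPathSum.lean`) of the register chain with
* site weights `Wa`: at the sites `i < 2r` the indicator `[x_i = a_i]` times the letter phase (conditioning on the prefix), at the
  sites `2r ≤ i < n` the sign of the MIDDLE bell `i − r` — read off the register (`midLetters`, window `[i−2r, i]`) and the decoded
  walk state `backPos σ r = st u (i−r)` — times the letter phase (`epsMid`, **`epsMid_spec`**);
* final vector `fFin`: the phase of the last letter `x_n = u_{n−1}`, the indicator `[st u n = τ]`, and the signs of the BOUNDARY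
  bells `k < r` and `n − r ≤ k ≤ n`, whose cyclic windows lie in the prefix and in the final register (`finLetters`, positions from
  `stFwd` / `backPos`; **`fFin_spec`**),
summed over `a` (exactly one prefix matches): **`pointwise_eq`**.

WHAT THIS IS NOT: no bound here (`TwistBoundX3LocalProof.lean`); crux 22907 untouched; separation NOT moved.
-/

noncomputable section

namespace Summit.QuantumAdvantage.AdviceFreeQNC0

open Finset Literature.Computability.MetaComplexity Literature.Computability.QuantumComplexity

namespace BondTwist3

open TransferWalk ConstBells TwistedTransfer

variable {n r : ℕ}

/-! ## Cyclic windows of middle and boundary cuts -/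

/-- Unpacking the cyclic distance: near without wrap, or wrapping above, or wrapping below. -/
theorem cycNear_cases {N r : ℕ} {j k : Fin N} (h : CycNear N r j k) :
    (j.val ≤ k.val + r ∧ k.val ≤ j.val + r) ∨ k.val + N ≤ j.val + r ∨ j.val + N ≤ k.val + r := by
  have hj := j.isLt; have hk := k.isLt
  unfold CycNear at h
  rcases Nat.lt_trichotomy j.val k.val with hlt | heq | hgt
  · -- `j < k`
    have e1 : (j.val + N - k.val) % N = N - (k.val - j.val) := by
      rw [show j.val + N - k.val = N - (k.val - j.val) by omega]; exact Nat.mod_eq_of_lt (by omega)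
    have e2 : (k.val + N - j.val) % N = k.val - j.val := by
      rw [show k.val + N - j.val = (k.val - j.val) + N by omega, Nat.add_mod_right]; exact Nat.mod_eq_of_lt (by omega)
    rw [e1, e2] at h
    omega
  · exact Or.inl ⟨by omega, by omega⟩
  · have e1 : (j.val + N - k.val) % N = j.val - k.val := by
      rw [show j.val + N - k.val = (j.val - k.val) + N by omega, Nat.add_mod_right]; exact Nat.mod_eq_of_lt (by omega)
    have e2 : (k.val + N - j.val) % N = N - (j.val - k.val) := by
      rw [show k.val + N - j.val = N - (j.val - k.val) by omega]; exact Nat.mod_eq_of_lt (by omega)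
    rw [e1, e2] at h
    omega

/-! ## The sign factors -/

/-- The `ℕ`-indexed bell rule (`false` beyond the cuts). -/
def tN (t : Fin (n + 1) → (Fin (n + 1) → Bool) → Bool) (k : ℕ) (x : Fin (n + 1) → Bool) : Bool :=
  if h : k < n + 1 then t ⟨k, h⟩ x else false

/-- The sign of a cut: `−1` iff its bell fires and it is charged (`κ + position + τ ≠ 0`). -/
def sgnF (fires : Bool) (κ pos τ : ZMod 3) : ℂ := if (fires = true ∧ κ + pos + τ ≠ 0) then -1 else 1

/-- Sign factors are `±1`, norm `≤ 1`. -/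
theorem norm_sgnF_le (fires : Bool) (κ pos τ : ZMod 3) : ‖sgnF fires κ pos τ‖ ≤ 1 := by
  unfold sgnF; split_ifs <;> simp

/-! ## Middle sites -/

/-- The letters seen at the middle site `i` (state `σ` before letter `i`, new letter `b`): `x_j` for `i − 2r ≤ j < i` from the
register, `x_i = b`, `false` elsewhere. -/
def midLetters (i : ℕ) (σ : RegState r) (b : Bool) : Fin (n + 1) → Bool :=
  fun j => if h : i ≤ j.val + 2 * r ∧ j.val < i then σ.2.2 ⟨j.val + 2 * r - i, by omega⟩
    else if j.val = i then b else false

/-- The sign pattern of the middle site `i`: bell `i − r` fires on the letters seen, and is charged at the decoded walk state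
`backPos σ r = st u (i − r)`. -/
def epsMid (t : Fin (n + 1) → (Fin (n + 1) → Bool) → Bool) (κ τ : ZMod 3) (i : ℕ) (σ : RegState r) (b : Bool) : Bool :=
  decide (tN t (i - r) (midLetters i σ b) = true ∧ κ + backPos σ r + τ ≠ 0)

/-- At a middle site of the true trajectory the letters seen ARE the letters, on the window `[i − 2r, i]`. -/
theorem midLetters_stU (u : Fin n → Bool) {i : ℕ} (hi : i < n) (j : Fin (n + 1)) (hj1 : i ≤ j.val + 2 * r)
    (hj2 : j.val ≤ i) : midLetters i (stU r u i) (xs u i) j = xOfU u j := by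
  unfold midLetters
  by_cases hlt : j.val < i
  · rw [dif_pos ⟨hj1, hlt⟩]
    show regU r u i ⟨j.val + 2 * r - i, _⟩ = xOfU u j
    unfold regU
    simp only
    rw [if_pos (by omega), show i + (j.val + 2 * r - i) - 2 * r = j.val by omega]
    unfold xs; rw [dif_pos j.isLt]
  · rw [dif_neg (fun h => hlt h.2), if_pos (by omega)]
    unfold xs; rw [dif_pos (show i < n + 1 by omega)]
    congr 1; exact Fin.ext (by simp; omega)

/-- **The middle sign is the sign of bell `i − r`** (`2r ≤ i < n`, `t` `r`-local). -/
theorem epsMid_spec {t : Fin (n + 1) → (Fin (n + 1) → Bool) → Bool} (hloc : IsLocalRule (n + 1) r t) (κ τ : ZMod 3)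
    (u : Fin n → Bool) {i : ℕ} (h2r : 2 * r ≤ i) (hi : i < n) :
    (if epsMid t κ τ i (stU r u i) (xs u i) = true then (-1 : ℂ) else 1) =
      sgnF (tN t (i - r) (xOfU u)) κ (st u (i - r)) τ := by
  have hfire : tN t (i - r) (midLetters i (stU r u i) (xs u i)) = tN t (i - r) (xOfU u) := by
    unfold tN
    have hlt : i - r < n + 1 := by omega
    rw [dif_pos hlt, dif_pos hlt]
    refine hloc _ _ ⟨i - r, hlt⟩ fun j hj => ?_
    rcases cycNear_cases hj with h | h | h
    · simp only at h
      exact midLetters_stU u hi j (by omega) (by omega)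
    · exfalso; simp only at h; have := j.isLt; omega
    · exfalso; simp only at h; omega
  have hpos : backPos (stU r u i) r = st u (i - r) := backPos_stU u hi.le r (by omega) (by omega)
  unfold epsMid sgnF
  rw [hfire, hpos]
  by_cases h : tN t (i - r) (xOfU u) = true ∧ κ + st u (i - r) + τ ≠ 0
  · rw [decide_eq_true h, if_pos rfl, if_pos h]
  · rw [decide_eq_false h, if_neg (by decide), if_neg h]

/-! ## The final vector -/

/-- The letters seen at the end (prefix `a`, final state `σ` before the last letter): `a` on `[0, 2r)`, the spin `u_{n−1} = x_n` at
`n`, the register on `[n − 2r, n)`, `false` elsewhere. -/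
def finLetters (a : Fin (2 * r) → Bool) (σ : RegState r) : Fin (n + 1) → Bool :=
  fun j => if h : j.val < 2 * r then a ⟨j.val, h⟩
    else if j.val = n then σ.2.1
    else if h2 : n ≤ j.val + 2 * r ∧ j.val < n then σ.2.2 ⟨j.val + 2 * r - n, by omega⟩ else false

/-- The walk state of a boundary cut: forward from the prefix (`k < r`) or decoded backward from the final state. -/
def posB (n : ℕ) (a : Fin (2 * r) → Bool) (σ : RegState r) (k : ℕ) : ZMod 3 :=
  if k < r then stFwd a k else backPos σ (n - k)

/-- **The final vector** of prefix `a` and guess `τ`: last-letter phase, final-state indicator, boundary-bell signs. -/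
def fFin (γ : Fin (n + 1) → ZMod 3) (t : Fin (n + 1) → (Fin (n + 1) → Bool) → Bool) (κ τ : ZMod 3)
    (a : Fin (2 * r) → Bool) (σ : RegState r) : ℂ :=
  (if σ.2.1 then phase γ n else 1) * (if -σ.1 = τ then 1 else 0) *
    ((∏ k ∈ range r, sgnF (tN t k (finLetters a σ)) κ (posB n a σ k) τ) *
     (∏ k ∈ Ico (n - r) (n + 1), sgnF (tN t k (finLetters a σ)) κ (posB n a σ k) τ))

/-- A product of sign factors has norm `≤ 1`. -/
theorem norm_prod_sgnF_le (s : Finset ℕ) (F : ℕ → Bool) (κ τ : ZMod 3) (P : ℕ → ZMod 3) :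
    ‖∏ k ∈ s, sgnF (F k) κ (P k) τ‖ ≤ 1 := by
  rw [norm_prod]
  exact Finset.prod_le_one (fun k _ => norm_nonneg _) fun k _ => norm_sgnF_le _ _ _ _

/-- The final vector is pointwise bounded by `1`. -/
theorem norm_fFin_le (γ : Fin (n + 1) → ZMod 3) (t : Fin (n + 1) → (Fin (n + 1) → Bool) → Bool) (κ τ : ZMod 3)
    (a : Fin (2 * r) → Bool) (σ : RegState r) : ‖fFin γ t κ τ a σ‖ ≤ 1 := by
  unfold fFin
  rw [norm_mul, norm_mul, norm_mul]
  have h1 : ‖(if σ.2.1 then phase γ n else 1 : ℂ)‖ ≤ 1 := by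
    split_ifs
    · exact norm_phase_le_one γ n
    · simp
  have h2 : ‖(if -σ.1 = τ then (1 : ℂ) else 0)‖ ≤ 1 := by split_ifs <;> simp
  have h3 := norm_prod_sgnF_le (range r) (fun k => tN t k (finLetters a σ)) κ τ (posB n a σ)
  have h4 := norm_prod_sgnF_le (Ico (n - r) (n + 1)) (fun k => tN t k (finLetters a σ)) κ τ (posB n a σ)
  exact mul_le_one₀ (mul_le_one₀ h1 (norm_nonneg _) h2) (by positivity) (mul_le_one₀ h3 (norm_nonneg _) h4)

/-- The last letter is the last free walk bit: `x_n = u_{n−1}`. -/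
theorem xs_last (u : Fin n → Bool) : xs u n = sPrev u n := by
  rw [xs_eq u (by omega)]
  have : uExt u n = true := by unfold uExt; rw [dif_neg (by omega)]
  rw [this]
  cases sPrev u n <;> rfl

/-- At the end of the true trajectory of a pattern with prefix `a`, the letters seen ARE the letters on `[0,2r) ∪ [n−2r, n]`. -/
theorem finLetters_stU {a : Fin (2 * r) → Bool} (u : Fin n → Bool) (ha : HasPrefix a u) (j : Fin (n + 1))
    (hj : j.val < 2 * r ∨ n ≤ j.val + 2 * r) : finLetters a (stU r u n) j = xOfU u j := by
  have hxj : xOfU u j = xs u j.val := by unfold xs; rw [dif_pos j.isLt]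
  rw [hxj]
  unfold finLetters
  by_cases h1 : j.val < 2 * r
  · rw [dif_pos h1, ha j.val h1]; unfold aExt; rw [dif_pos h1]
  · rw [dif_neg h1]
    by_cases h2 : j.val = n
    · rw [if_pos h2, h2, xs_last u]; rfl
    · have hj' : n ≤ j.val + 2 * r ∧ j.val < n := ⟨by omega, by have := j.isLt; omega⟩
      rw [if_neg h2, dif_pos hj']
      show regU r u n ⟨j.val + 2 * r - n, _⟩ = xs u j.val
      unfold regU
      simp only
      rw [if_pos (by omega), show n + (j.val + 2 * r - n) - 2 * r = j.val by omega]

/-- **The final vector on the true trajectory** (`4r + 3 ≤ n`, prefix `a`, `t` `r`-local). -/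
theorem fFin_spec {t : Fin (n + 1) → (Fin (n + 1) → Bool) → Bool} (hloc : IsLocalRule (n + 1) r t)
    (γ : Fin (n + 1) → ZMod 3) (κ τ : ZMod 3) {a : Fin (2 * r) → Bool} (u : Fin n → Bool) (hn : 4 * r + 3 ≤ n)
    (ha : HasPrefix a u) :
    fFin γ t κ τ a (stU r u n) =
      (if xs u n then phase γ n else 1) * (if st u n = τ then 1 else 0) *
        ((∏ k ∈ range r, sgnF (tN t k (xOfU u)) κ (st u k) τ) *
         (∏ k ∈ Ico (n - r) (n + 1), sgnF (tN t k (xOfU u)) κ (st u k) τ)) := by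
  have hfire : ∀ k : ℕ, (k < r ∨ n ≤ k + r) → tN t k (finLetters a (stU r u n)) = tN t k (xOfU u) := by
    intro k hk
    unfold tN
    split_ifs with hkn
    · refine hloc _ _ ⟨k, hkn⟩ fun j hj => finLetters_stU u ha j ?_
      rcases cycNear_cases hj with h | h | h <;> simp only at h <;> omega
    · rfl
  have hspin : (stU r u n).2.1 = xs u n := by rw [xs_last u]; rfl
  have hposS : (stU r u n).1 = -st u n := rfl
  unfold fFin
  rw [hspin, hposS, neg_neg]
  congr 1
  have hstart : ∀ k ∈ range r, sgnF (tN t k (finLetters a (stU r u n))) κ (posB n a (stU r u n) k) τ =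
      sgnF (tN t k (xOfU u)) κ (st u k) τ := by
    intro k hk
    rw [mem_range] at hk
    rw [hfire k (Or.inl hk)]
    unfold posB
    rw [if_pos hk, stFwd_eq (by omega) ha k (by omega)]
  have hend : ∀ k ∈ Ico (n - r) (n + 1), sgnF (tN t k (finLetters a (stU r u n))) κ (posB n a (stU r u n) k) τ =
      sgnF (tN t k (xOfU u)) κ (st u k) τ := by
    intro k hk
    rw [mem_Ico] at hk
    rw [hfire k (Or.inr (by omega))]
    unfold posB
    rw [if_neg (by omega), backPos_stU u le_rfl (n - k) (by omega) (by omega), show n - (n - k) = k by omega]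
  rw [prod_congr rfl hstart, prod_congr rfl hend]

/-! ## The site weights -/

/-- **The site weights** of prefix `a`: prefix indicator (sites `< 2r`) or middle sign (sites `≥ 2r`), times the letter phase. -/
def Wa (γ : Fin (n + 1) → ZMod 3) (t : Fin (n + 1) → (Fin (n + 1) → Bool) → Bool) (κ τ : ZMod 3)
    (a : Fin (2 * r) → Bool) (i : ℕ) (σ : RegState r) (b : Bool) : ℂ :=
  (if i < 2 * r then (if b = aExt a i then (1 : ℂ) else 0) else (if epsMid t κ τ i σ b then -1 else 1)) *
    (if b then phase γ i else 1)

/-- The site weights have norm `≤ 1`. -/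
theorem norm_Wa_le (γ : Fin (n + 1) → ZMod 3) (t : Fin (n + 1) → (Fin (n + 1) → Bool) → Bool) (κ τ : ZMod 3)
    (a : Fin (2 * r) → Bool) (i : ℕ) (σ : RegState r) (b : Bool) : ‖Wa γ t κ τ a i σ b‖ ≤ 1 := by
  unfold Wa
  rw [norm_mul]
  have h1 : ‖(if i < 2 * r then (if b = aExt a i then (1 : ℂ) else 0) else (if epsMid t κ τ i σ b then -1 else 1))‖ ≤ 1 := by
    split_ifs <;> simp
  have h2 : ‖(if b then phase γ i else 1 : ℂ)‖ ≤ 1 := by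
    split_ifs
    · exact norm_phase_le_one γ i
    · simp
  exact mul_le_one₀ h1 (norm_nonneg _) h2

/-- Beyond the prefix the site weights are of sign-and-phase form. -/
theorem Wa_eq_signW (γ : Fin (n + 1) → ZMod 3) (t : Fin (n + 1) → (Fin (n + 1) → Bool) → Bool) (κ τ : ZMod 3)
    (a : Fin (2 * r) → Bool) {i : ℕ} (hi : 2 * r ≤ i) : Wa γ t κ τ a i = signW (phase γ i) (epsMid t κ τ i) := by
  funext σ b
  unfold Wa signW
  rw [if_neg (by omega)]

/-! ## The pointwise identity -/

/-- The prefix of `u`. -/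
def prefixOf (r : ℕ) (u : Fin n → Bool) : Fin (2 * r) → Bool := fun m => xs u m.val

/-- `u` has its own prefix. -/
theorem hasPrefix_prefixOf (u : Fin n → Bool) : HasPrefix (prefixOf r u) u := by
  intro j hj; unfold aExt prefixOf; rw [dif_pos hj]

/-- The path weight of a non-matching prefix vanishes (`2r ≤ n`). -/
theorem pathW_eq_zero_of_ne (γ : Fin (n + 1) → ZMod 3) (t : Fin (n + 1) → (Fin (n + 1) → Bool) → Bool) (κ τ : ZMod 3)
    {a : Fin (2 * r) → Bool} (u : Fin n → Bool) (hrn : 2 * r ≤ n) (ha : a ≠ prefixOf r u) :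
    pathW (Wa γ t κ τ a) (fFin γ t κ τ a) 0 (initState r) n (xs u) = 0 := by
  obtain ⟨m, hm⟩ := Function.ne_iff.1 ha
  unfold pathW
  apply mul_eq_zero_of_left
  apply Finset.prod_eq_zero (mem_range.2 (show m.val < n by omega))
  unfold Wa
  rw [zero_add, if_pos m.isLt]
  have hne : xs u m.val ≠ aExt a m.val := by
    unfold aExt; rw [dif_pos m.isLt]; intro h; exact hm (h ▸ rfl)
  rw [if_neg hne, zero_mul]

/-- Re-indexing the middle signs: `Π_{m ∈ [2r, n)} s (m − r) = Π_{k ∈ [r, n − r)} s k` (`2r ≤ n`). -/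
theorem prod_Ico_shift (s : ℕ → ℂ) (hrn : 2 * r ≤ n) :
    ∏ m ∈ Ico (2 * r) n, s (m - r) = ∏ k ∈ Ico r (n - r), s k := by
  have h := Finset.prod_Ico_add' (fun m => s (m - r)) r (n - r) r
  rw [show r + r = 2 * r by ring, show n - r + r = n by omega] at h
  rw [← h]
  exact prod_congr rfl fun k _ => by rw [Nat.add_sub_cancel]

/-- **THE POINTWISE IDENTITY**: the twisted, `τ`-resolved sign weight of `u` is the sum over prefixes of the explicit path weights
(`4r + 3 ≤ n`, `t` `r`-local). -/
theorem pointwise_eq {t : Fin (n + 1) → (Fin (n + 1) → Bool) → Bool} (hloc : IsLocalRule (n + 1) r t)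
    (γ : Fin (n + 1) → ZMod 3) (κ τ : ZMod 3) (hn : 4 * r + 3 ≤ n) (u : Fin n → Bool) :
    (ZMod.stdAddChar (∑ i : Fin (n + 1), if xOfU u i then γ i else 0) : ℂ) *
        ((if st u n = τ then (1 : ℂ) else 0) * ∏ g : Fin (n + 1), sgnF (t g (xOfU u)) κ (st u g.val) τ) =
      ∑ a : Fin (2 * r) → Bool, pathW (Wa γ t κ τ a) (fFin γ t κ τ a) 0 (initState r) n (xs u) := by
  classical
  -- only the true prefix contributes
  rw [Finset.sum_eq_single (prefixOf r u)
    (fun a _ ha => pathW_eq_zero_of_ne γ t κ τ u (by omega) ha) (fun h => absurd (mem_univ _) h)]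
  set a := prefixOf r u with haDef
  have ha : HasPrefix a u := hasPrefix_prefixOf u
  -- the path weight along the true trajectory
  unfold pathW
  rw [traj_xs u n le_rfl, fFin_spec hloc γ κ τ u hn ha]
  have htraj : ∀ m ∈ range n, Wa γ t κ τ a (0 + m) (traj (xs u) (initState r) m) (xs u m) =
      (if m < 2 * r then (1 : ℂ) else sgnF (tN t (m - r) (xOfU u)) κ (st u (m - r)) τ) *
        (if xs u m then phase γ m else 1) := by
    intro m hm
    rw [mem_range] at hm
    rw [zero_add, traj_xs u m hm.le]
    unfold Wa
    by_cases h2 : m < 2 * r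
    · rw [if_pos h2, if_pos h2, if_pos (ha m h2)]
    · rw [if_neg h2, if_neg h2, epsMid_spec hloc κ τ u (by omega) hm]
  rw [prod_congr rfl htraj, prod_mul_distrib]
  -- the phase: all letters
  have hphase : (∏ m ∈ range n, (if xs u m then phase γ m else 1 : ℂ)) * (if xs u n then phase γ n else 1) =
      (ZMod.stdAddChar (∑ i : Fin (n + 1), if xOfU u i then γ i else 0) : ℂ) := by
    rw [char_eq_prod, ← Finset.prod_range_succ (fun m => (if xs u m then phase γ m else 1 : ℂ)) n,
      ← Fin.prod_univ_eq_prod_range (fun m => (if xs u m then phase γ m else 1 : ℂ)) (n + 1)]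
    refine prod_congr rfl fun i _ => ?_
    have : xs u i.val = xOfU u i := by unfold xs; rw [dif_pos i.isLt]
    rw [this]
  -- the middle signs
  have hmid : (∏ m ∈ range n, (if m < 2 * r then (1 : ℂ) else sgnF (tN t (m - r) (xOfU u)) κ (st u (m - r)) τ)) =
      ∏ k ∈ Ico r (n - r), sgnF (tN t k (xOfU u)) κ (st u k) τ := by
    rw [range_eq_Ico, ← prod_Ico_consecutive _ (Nat.zero_le (2 * r)) (show 2 * r ≤ n by omega)]
    have h1 : (∏ m ∈ Ico 0 (2 * r), (if m < 2 * r then (1 : ℂ) else sgnF (tN t (m - r) (xOfU u)) κ (st u (m - r)) τ)) = 1 :=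
      prod_eq_one fun m hm => by rw [mem_Ico] at hm; rw [if_pos hm.2]
    have h2 : (∏ m ∈ Ico (2 * r) n, (if m < 2 * r then (1 : ℂ) else sgnF (tN t (m - r) (xOfU u)) κ (st u (m - r)) τ)) =
        ∏ m ∈ Ico (2 * r) n, sgnF (tN t (m - r) (xOfU u)) κ (st u (m - r)) τ :=
      prod_congr rfl fun m hm => by rw [mem_Ico] at hm; rw [if_neg (by omega)]
    rw [h1, one_mul, h2]
    exact prod_Ico_shift (fun k => sgnF (tN t k (xOfU u)) κ (st u k) τ) (by omega)
  -- all signs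
  have hall : (∏ g : Fin (n + 1), sgnF (t g (xOfU u)) κ (st u g.val) τ) =
      (∏ k ∈ range r, sgnF (tN t k (xOfU u)) κ (st u k) τ) *
        ((∏ k ∈ Ico r (n - r), sgnF (tN t k (xOfU u)) κ (st u k) τ) *
         (∏ k ∈ Ico (n - r) (n + 1), sgnF (tN t k (xOfU u)) κ (st u k) τ)) := by
    have e1 : (∏ g : Fin (n + 1), sgnF (t g (xOfU u)) κ (st u g.val) τ) =
        ∏ g : Fin (n + 1), sgnF (tN t g.val (xOfU u)) κ (st u g.val) τ :=
      prod_congr rfl fun g _ => by unfold tN; rw [dif_pos g.isLt]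
    rw [e1, Fin.prod_univ_eq_prod_range (fun k => sgnF (tN t k (xOfU u)) κ (st u k) τ) (n + 1), range_eq_Ico,
      ← prod_Ico_consecutive _ (Nat.zero_le r) (show r ≤ n + 1 by omega),
      ← prod_Ico_consecutive _ (show r ≤ n - r by omega) (show n - r ≤ n + 1 by omega), ← range_eq_Ico]
  rw [hmid, hall, ← hphase]
  ring

end BondTwist3

end Summit.QuantumAdvantage.AdviceFreeQNC0

end
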